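import Summits.AtomisticToContinuum.Crystallization.Theorems.ChessboardParticlePlanesPeriodicWindowsGoodLimitA
import Summits.AtomisticToContinuum.Crystallization.Theorems.ChessboardParticlePlanesPeriodicWindowsGoodLimitC

/-!
# Crux `PeriodicWindows` (stmt-AtomisticToContinuum-3240), line `Sketch` — stub `stub_goodLimit`

Step E0a of the lead skeleton `PeriodicWindowsSketch` (pure compactness): GOOD windows of the
configurations `y k` about the particles `i₀ k` at scale `(k + 2, 1/(k + 1))` — `ε`-flat levels
with gaps `≥ 19/25`, `19/20`-separation, exactly `6 + 3 + 3` neighbours within distance `1` with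
`ε`-sharp lengths `a_k` (same level) and `b_k` (adjacent levels), `a_k, b_k ∈ [19/20, 1]` — have,
along a strictly increasing `φ` and after ONE linear isometry `B` taking the limit unit normal to
`e₃`, a `19/20`-separated local two-way-matching limit `X ∋ 0` of the rotated recentred windows
which is an EXACT two-length layered configuration.

Assembly of parts A (per-window bookkeeping), B (limit infrastructure, `0 ∈ X`, gap and sharpness
clauses) and C (the unified neighbour clause):
1. extract `φ₁` with `(a, b, n) ∘ φ₁ → (alim, blim, nlim)` in the compact
   `[19/20, 1]² × 𝕊²` (`IsCompact.tendsto_subseq`);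
2. `B :=` the reflection exchanging `nlim` and `e₃` (`Submodule.reflection_sub`), so that
   `(B z) 2 = ⟪z, nlim⟫` (`gl_exists_rotation_height`);
3. `exists_subseq_forall_eventually_ballMatch` on the `19/20`-separated rotated recentred windows
   along `φ₁` gives `φ₂`, the separated limit `X` and the matching; `φ = φ₁ ∘ φ₂`;
4. the clauses are `gl_zero_mem_limit`, `gl_gap_clause`, `gl_sharp_clause` and three instances
   (`σ = 0, 1, -1`) of `gl_nbr_clause`, fed by `gl_levels_dichotomy_or`, `gl_sharp_of_inner_lt`,
   `gl_six_indices`, `gl_up_indices`, `gl_down_indices` at the window `φ k`.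
-/

noncomputable section

namespace Summit.AtomisticToContinuum.Crystallization.Theorems.PeriodicWindowsSketch

open Literature.MathematicalPhysics.StatisticalMechanics Filter Metric Topology

/-- A linear isometry of `ℝ³` taking the unit vector `nlim` to `e₃` (the reflection in the
hyperplane orthogonal to `nlim - e₃`), phrased through heights: `(B z) 2 = ⟪z, nlim⟫`. -/
theorem gl_exists_rotation_height (nlim : EuclideanSpace ℝ (Fin 3)) (hn : ‖nlim‖ = 1) :
    ∃ B : EuclideanSpace ℝ (Fin 3) ≃ₗᵢ[ℝ] EuclideanSpace ℝ (Fin 3),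
      ∀ z : EuclideanSpace ℝ (Fin 3), (B z) 2 = inner ℝ z nlim := by
  obtain ⟨B, hBn⟩ : ∃ B : EuclideanSpace ℝ (Fin 3) ≃ₗᵢ[ℝ] EuclideanSpace ℝ (Fin 3),
      B nlim = EuclideanSpace.single (2 : Fin 3) (1 : ℝ) :=
    ⟨Submodule.reflection (ℝ ∙ (nlim - EuclideanSpace.single (2 : Fin 3) (1 : ℝ)))ᗮ,
      Submodule.reflection_sub (by rw [hn]; simp)⟩
  refine ⟨B, fun z => ?_⟩
  have h2 : (B z) 2 = inner ℝ (B z) (EuclideanSpace.single (2 : Fin 3) (1 : ℝ)) := by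
    rw [EuclideanSpace.inner_single_right]
    simp
  rw [h2, ← hBn, LinearIsometryEquiv.inner_map_map]

/-- STUB E0a (pure compactness, no potential): GOOD windows of the configurations `y k` about the
particles `i₀ k` at scale `(k + 2, 1/(k + 1))` have — along a strictly increasing `φ` and after
one linear isometry `B` taking the limit unit normal to `e₃` — a `19/20`-separated local
two-way-matching limit `X ∋ 0` of the rotated recentred windows which is an EXACT two-length
layered configuration: heights `· 2` pairwise equal or `≥ 19/25` apart, same-height pairs closer
than `1` at distance exactly `a`, at every point six same-height points at distance `a`, three
points at a common height `+g` and three at a common height `-g'` (`g, g' > 0`) at distance `b`. -/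
theorem stub_goodLimit (nn : ℕ → ℕ) (y : (k : ℕ) → Fin (nn k) → EuclideanSpace ℝ (Fin 3))
    (i₀ : (k : ℕ) → Fin (nn k))
    (hgood : ∀ k : ℕ, ∃ a b : ℝ, 19 / 20 ≤ a ∧ a ≤ 1 ∧ 19 / 20 ≤ b ∧ b ≤ 1 ∧
      ∃ n : EuclideanSpace ℝ (Fin 3), ‖n‖ = 1 ∧ ∃ c : ℤ → ℝ, (∀ m : ℤ, c m + 19 / 25 ≤ c (m + 1)) ∧
      ∃ l : Fin (nn k) → ℤ,
        (∀ j : Fin (nn k), dist (y k j) (y k (i₀ k)) ≤ (k : ℝ) + 2 →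
          |inner ℝ (y k j - y k (i₀ k)) n - c (l j)| ≤ 1 / ((k : ℝ) + 1)) ∧
        (∀ j j' : Fin (nn k), dist (y k j) (y k (i₀ k)) ≤ (k : ℝ) + 2 →
          dist (y k j') (y k (i₀ k)) ≤ (k : ℝ) + 2 → j ≠ j' → 19 / 20 ≤ dist (y k j) (y k j')) ∧
        ∀ j : Fin (nn k), dist (y k j) (y k (i₀ k)) ≤ ((k : ℝ) + 2) / 2 →
          Nat.card {j' : Fin (nn k) // j' ≠ j ∧ l j' = l j ∧ dist (y k j) (y k j') ≤ 1} = 6 ∧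
          Nat.card {j' : Fin (nn k) // l j' = l j + 1 ∧ dist (y k j) (y k j') ≤ 1} = 3 ∧
          Nat.card {j' : Fin (nn k) // l j' = l j - 1 ∧ dist (y k j) (y k j') ≤ 1} = 3 ∧
          ∀ j' : Fin (nn k), j' ≠ j → dist (y k j) (y k j') ≤ 1 →
            (l j' = l j → |dist (y k j) (y k j') - a| ≤ 1 / ((k : ℝ) + 1)) ∧
            (l j' ≠ l j → |dist (y k j) (y k j') - b| ≤ 1 / ((k : ℝ) + 1))) :
    ∃ (φ : ℕ → ℕ) (B : EuclideanSpace ℝ (Fin 3) ≃ₗᵢ[ℝ] EuclideanSpace ℝ (Fin 3))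
      (X : Set (EuclideanSpace ℝ (Fin 3))) (a b : ℝ), StrictMono φ ∧
      (∀ R ε : ℝ, 0 < ε → ∀ᶠ k in Filter.atTop,
        BallMatch ε R 0 {p | ∃ j : Fin (nn (φ k)),
          dist (y (φ k) j) (y (φ k) (i₀ (φ k))) ≤ (φ k : ℝ) + 2 ∧
          p = B (y (φ k) j - y (φ k) (i₀ (φ k)))} X) ∧
      (0 : EuclideanSpace ℝ (Fin 3)) ∈ X ∧ 19 / 20 ≤ a ∧ a ≤ 1 ∧ 19 / 20 ≤ b ∧ b ≤ 1 ∧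
      (∀ p ∈ X, ∀ q ∈ X, p ≠ q → 19 / 20 ≤ dist p q) ∧
      (∀ p ∈ X, ∀ q ∈ X, q 2 = p 2 ∨ 19 / 25 ≤ |q 2 - p 2|) ∧
      (∀ p ∈ X, ∀ q ∈ X, p ≠ q → dist p q < 1 → q 2 = p 2 → dist p q = a) ∧
      (∀ p ∈ X, ∃ F : Finset (EuclideanSpace ℝ (Fin 3)), F.card = 6 ∧
        ∀ q ∈ F, q ∈ X ∧ q 2 = p 2 ∧ dist p q = a) ∧
      (∀ p ∈ X, ∃ g : ℝ, 0 < g ∧ ∃ F : Finset (EuclideanSpace ℝ (Fin 3)), F.card = 3 ∧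
        ∀ q ∈ F, q ∈ X ∧ q 2 = p 2 + g ∧ dist p q = b) ∧
      (∀ p ∈ X, ∃ g : ℝ, 0 < g ∧ ∃ F : Finset (EuclideanSpace ℝ (Fin 3)), F.card = 3 ∧
        ∀ q ∈ F, q ∈ X ∧ q 2 = p 2 - g ∧ dist p q = b) := by
  choose a b ha1 ha2 hb1 hb2 n hn c hc l hflat hsepW hnbr using hgood
  -- Step 1: extract `(a, b, n) ∘ φ₁ → (alim, blim, nlim)` in `[19/20, 1]² × 𝕊²`.
  obtain ⟨⟨alim, blim, nlim⟩, ⟨⟨hal1, hal2⟩, ⟨hbl1, hbl2⟩, hnl⟩, φ₁, hφ₁, hlim1⟩ :=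
    (isCompact_Icc.prod (isCompact_Icc.prod
      (isCompact_sphere (0 : EuclideanSpace ℝ (Fin 3)) 1))).tendsto_subseq
      (x := fun k => (a k, b k, n k))
      (fun k => ⟨⟨ha1 k, ha2 k⟩, ⟨hb1 k, hb2 k⟩, mem_sphere_zero_iff_norm.2 (hn k)⟩)
  have hta : Tendsto (fun k => a (φ₁ k)) atTop (𝓝 alim) := hlim1.fst_nhds
  have htb : Tendsto (fun k => b (φ₁ k)) atTop (𝓝 blim) := hlim1.snd_nhds.fst_nhds
  have htn : Tendsto (fun k => n (φ₁ k)) atTop (𝓝 nlim) := hlim1.snd_nhds.snd_nhds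
  -- Step 2: the rotation taking `nlim` to `e₃`.
  obtain ⟨B, hB⟩ := gl_exists_rotation_height nlim (mem_sphere_zero_iff_norm.1 hnl)
  -- Step 3: local matching compactness of the rotated recentred windows along `φ₁`.
  obtain ⟨φ₂, X, hφ₂, hsepX, hmatch⟩ :=
    exists_subseq_forall_eventually_ballMatch (by norm_num : (0 : ℝ) < 19 / 20)
      (fun k => {p : EuclideanSpace ℝ (Fin 3) | ∃ j : Fin (nn (φ₁ k)),
        dist (y (φ₁ k) j) (y (φ₁ k) (i₀ (φ₁ k))) ≤ (φ₁ k : ℝ) + 2 ∧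
        p = B (y (φ₁ k) j - y (φ₁ k) (i₀ (φ₁ k)))})
      (by
        rintro k p ⟨j, hj, rfl⟩ q ⟨j', hj', rfl⟩ hpq
        rw [gl_dist_map_sub_sub]
        exact hsepW (φ₁ k) j j' hj hj' fun h => hpq (by rw [h]))
  -- Step 4: the limit-level data along `φ = φ₁ ∘ φ₂`.
  have hφ : StrictMono fun k => φ₁ (φ₂ k) := hφ₁.comp hφ₂
  have hR : Tendsto (fun k => ((φ₁ (φ₂ k) : ℕ) : ℝ) + 2) atTop atTop :=
    tendsto_atTop_add_const_right _ 2 (tendsto_natCast_atTop_atTop.comp hφ.tendsto_atTop)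
  have hη : Tendsto (fun k => 1 / (((φ₁ (φ₂ k) : ℕ) : ℝ) + 1)) atTop (𝓝 0) :=
    tendsto_one_div_add_atTop_nhds_zero_nat.comp hφ.tendsto_atTop
  have hnrm : Tendsto (fun k => n (φ₁ (φ₂ k))) atTop (𝓝 nlim) := htn.comp hφ₂.tendsto_atTop
  have hLa : Tendsto (fun k => a (φ₁ (φ₂ k))) atTop (𝓝 alim) := hta.comp hφ₂.tendsto_atTop
  have hLb : Tendsto (fun k => b (φ₁ (φ₂ k))) atTop (𝓝 blim) := htb.comp hφ₂.tendsto_atTop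
  have hmatch' : ∀ r ε : ℝ, 0 < ε → ∀ᶠ k in atTop, BallMatch ε r 0
      {p | ∃ j : Fin (nn (φ₁ (φ₂ k))),
        dist (y (φ₁ (φ₂ k)) j) (y (φ₁ (φ₂ k)) (i₀ (φ₁ (φ₂ k)))) ≤ ((φ₁ (φ₂ k) : ℕ) : ℝ) + 2 ∧
        p = B (y (φ₁ (φ₂ k)) j - y (φ₁ (φ₂ k)) (i₀ (φ₁ (φ₂ k))))} X := hmatch
  have hsepW' : ∀ (k : ℕ) (j j' : Fin (nn (φ₁ (φ₂ k)))),
      dist (y (φ₁ (φ₂ k)) j) (y (φ₁ (φ₂ k)) (i₀ (φ₁ (φ₂ k)))) ≤ ((φ₁ (φ₂ k) : ℕ) : ℝ) + 2 →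
      dist (y (φ₁ (φ₂ k)) j') (y (φ₁ (φ₂ k)) (i₀ (φ₁ (φ₂ k)))) ≤ ((φ₁ (φ₂ k) : ℕ) : ℝ) + 2 →
      j ≠ j' → 19 / 20 ≤ dist (y (φ₁ (φ₂ k)) j) (y (φ₁ (φ₂ k)) j') := fun k => hsepW (φ₁ (φ₂ k))
  have hR2 : ∀ k, (2 : ℝ) ≤ ((φ₁ (φ₂ k) : ℕ) : ℝ) + 2 := fun k => by
    linarith [(Nat.cast_nonneg (φ₁ (φ₂ k)) : (0 : ℝ) ≤ _)]
  refine ⟨fun k => φ₁ (φ₂ k), B, X, alim, blim, hφ, hmatch', gl_zero_mem_limit hR hsepX hmatch',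
    hal1, hal2, hbl1, hbl2, hsepX, ?_, ?_, ?_, ?_, ?_⟩
  · -- heights pairwise equal or `≥ 19/25` apart
    exact gl_gap_clause hR hη hnrm hB hmatch' fun k j j' hj hj' =>
      gl_levels_dichotomy_or (hc (φ₁ (φ₂ k))) (hflat (φ₁ (φ₂ k))) hj hj'
  · -- same-height pairs closer than `1` are at distance `alim`
    exact gl_sharp_clause hR hη hnrm hB hmatch' hLa fun k j j' hj hj' hne hd hlt =>
      gl_sharp_of_inner_lt (hc (φ₁ (φ₂ k))) (hflat (φ₁ (φ₂ k))) (hnbr (φ₁ (φ₂ k)))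
        (zero_le_two.trans (hR2 k)) hj hj' hne hd hlt
  · -- six same-height points at distance `alim`
    intro p hp
    obtain ⟨g, -, F, hF, hq⟩ := gl_nbr_clause hR hη hnrm hB hsepX hmatch' hsepW' 6 (Or.inl rfl) hLa
      (fun k J hJ =>
        gl_six_indices (hc (φ₁ (φ₂ k))) (hflat (φ₁ (φ₂ k))) (hnbr (φ₁ (φ₂ k))) (hR2 k) hJ)
      p hp
    exact ⟨F, hF, fun q hqF => ⟨(hq q hqF).1, by rw [(hq q hqF).2.1]; ring, (hq q hqF).2.2⟩⟩
  · -- three points at a common height `p 2 + g` at distance `blim`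
    intro p hp
    obtain ⟨g, hg, F, hF, hq⟩ := gl_nbr_clause hR hη hnrm hB hsepX hmatch' hsepW' 3
      (Or.inr (Or.inl rfl)) hLb
      (fun k J hJ =>
        gl_up_indices (hc (φ₁ (φ₂ k))) (hflat (φ₁ (φ₂ k))) (hnbr (φ₁ (φ₂ k))) (hR2 k) hJ)
      p hp
    exact ⟨g, hg, F, hF, fun q hqF => ⟨(hq q hqF).1, by rw [(hq q hqF).2.1]; ring, (hq q hqF).2.2⟩⟩
  · -- three points at a common height `p 2 - g` at distance `blim`
    intro p hp
    obtain ⟨g, hg, F, hF, hq⟩ := gl_nbr_clause hR hη hnrm hB hsepX hmatch' hsepW' 3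
      (Or.inr (Or.inr rfl)) hLb
      (fun k J hJ =>
        gl_down_indices (hc (φ₁ (φ₂ k))) (hflat (φ₁ (φ₂ k))) (hnbr (φ₁ (φ₂ k))) (hR2 k) hJ)
      p hp
    exact ⟨g, hg, F, hF, fun q hqF => ⟨(hq q hqF).1, by rw [(hq q hqF).2.1]; ring, (hq q hqF).2.2⟩⟩

end Summit.AtomisticToContinuum.Crystallization.Theorems.PeriodicWindowsSketch

end
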